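import Summits.QuantumFields.YangMills.Theorems.BalabanUVNodesN11RunGuardIsTopCube
import Summits.QuantumFields.YangMills.Theorems.BalabanUVNodesN11RunGuardInThm2Regime

/-!
# DAG node N11 — THE RUN GUARD FROM N11's OWN (2.6) ANTECEDENT: of the thirteen DAG mains only N11 = `Dag.B14_main` carries `(smallCouplings → flowControl)`, and the `leavesP`
# binding reads `flowControl` as [III] (2.6) p.255 (`B14.FlowIneq26 g β⁺ β₀ K`); the FIRST half of (2.6) at `n = K`, squared, IS the upper running w.r.t. the LAST coupling
# `1∕g_i² ≤ 1∕g_n² + β⁺·(n − i)` (`i ≤ n ≤ K`) — so INSIDE N11's node `PartCompat₁₃ θ p n` collapses to its LAST clause («the level-`n` 𝐃-cube fits the torus»): the compatible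
# levels are an INITIAL SEGMENT of the run and the one-block levels a TOP SEGMENT, with NO β-leaf and NO (0.31)

HEADER — WORK-UNIT METADATA.  Cell `pub-ymgap`, YM-PLAN Track A (HUMAN RULING D-0062 ∕ D-0149 width seats), seat `pub-ymgap-dag-n11-w4` (g5; WIDTH SEAT 4 of 4 on NODE n11
[B14]), route `BalabanUVNodes` rev 29, deciding item K1⁹ `StabilityBRunRowsAtRecordR13SepCoPHV` = stmt-QuantumFields-27364 (helper lane, `--kind proof --supports 27364 --as helper`,
count-neutral; dag-lead KEY MAP v2).  [III] = [Balaban1988Convergent], [I] = [Balaban1987RG1].  Over this seat's p623573 `…N11RunGuardIsTopCube` (`topDvd_of_partCompat₁₃`,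
`dCubeSide_dvd_iff_mul_dvd`), p615408 `…N11RunGuardIsCouplingFloor`, p611474 `…N11PartCompatOfTwoSidedRunning` (`partCompat₁₃_of_upperRunning`, `pow_add_ge_add`), p608879
`…N11PartCompatOfCouplings` (`partCompat₁₃_of_log_pow_le`, `log_pow_le_of_dCubeSide_le`, `room_of_dCubeSide_le`, `sitesPerDir_zero_eq`), p620293 `…N11RunGuardInThm2Regime`, and the
tree's `B14.FlowIneq26` ∕ `DagBinding.leavesP`.

WHY THIS FILE.  The run guard `PartCompat₁₃ θ p n` ([III] p.257 «all partitions are compatible», K0's row P11 antecedent, the no-expansion 𝐓-step's `hPC`) was LOCATED by this seat as a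
floor on the last coupling (p615408) resp. as the top-cube divisibility (p623573) — in each case from a RUN LETTER making `log g_i⁻²` grow only log-log below the top: the β-ceiling
along the run (p615408), print's (0.31) (p611474), or the `running` leaf of [I] Thm 2's regime (p620293).  None of these is an antecedent of N11's node statement.  But ONE is already
there: `Dag.B14_main ℓ = b7 → … → (smallCouplings → smallFieldInductive) → (smallCouplings → flowControl) → (rOperation → (smallCouplings → densitiesDescribed))`, and at the
binding `(leavesP w P).flowControl = B14.FlowIneq26 (w.C P).flow.g w.βup w.β₀ P.K` = [III] (2.6): `g_n ≤ (1 + g_n²β′(n−m))^{1∕2} g_m`, `g_m ≤ (1+β₀) g_n` (`m < n ≤ K`).  Its first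
half at `(m, n)` is, after squaring and dividing by `g_n²g_m² > 0`, `1∕g_m² ≤ 1∕g_n² + β⁺·(n − m)` — EXACTLY the upper running w.r.t. `g_n` (§1, three lines of algebra).  Hence (§2–§3):
from the node's OWN two antecedents `smallCouplings` (the window: positivity + `g_n ≤ γ`) and `flowControl`, plus the world scalars `0 ≤ β⁺`, `β⁺γ² ≤ 1`, the guard UP TO ANY
LEVEL `n ≤ K` follows from the level-`n` divisibility `L^n·M·R_n(g_n) ∣ 2L^{m+K}` alone — the compatible levels are an INITIAL SEGMENT of the run, the non-fitting (= one-block at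
`M = L^a`, p618164) levels a TOP SEGMENT; at `n = K`: the TOP divisibility (equivalently `M·R_K(g_K) ∣ 2L^m`, or the floor `log(1∕g_K² + β⁺) ≤ L^{m−a}`) gives the guard at every
level, and conversely compatibility at `K ≥ 1` contains that divisibility.  CONSEQUENCE for the K1 assembly's N11 face (typed in the sequel file): on the NODE road the compatible half costs ONE divisibility per run —
print's p.257 sentence at the top scale — and nothing from the β cell; the incompatible window runs of p615408 ∕ p617030 are exactly those whose top cube does not fit (BG-ONEBLOCK's
territory, p624439 §1–§2 ∕ dag-n11-w5).

WHAT THIS FILE PROVES (0 `sorry`, 0 `def`; standard axioms).  §1 (pure ℝ) ★ `inv_sq_le_inv_sq_add_of_flowIneq26` (any `i ≤ n ≤ K`) · `inv_sq_le_inv_sq_top_add_of_flowIneq26` (`n = K`) ·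
`le_one_add_mul_top_of_flowIneq26` (second half: `g_i ≤ (1+β₀)·g_K`) · `log_inv_sq_le_log_inv_sq_add_of_upperRunning` (the log-log step).  §2 generic θ (`θ.τ9.M = F.L^a`, `θ.ν.r = 1`): ★ `partCompat₁₃_of_logFloorAt_of_window_of_upperRunningAt` (ANY level
`n ≤ K`: room + log floor at level `n` + the upper running w.r.t. `g_n` ⇒ compatible up to `n`) · ★ `partCompat₁₃_of_dvdAt_of_window_of_upperRunningAt` (the same from the
level-`n` divisibility) · ★ `partCompat₁₃_of_topDvd_of_window_of_upperRunningTop` (`n = K`; p623573's ★★★ with the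
β-ceiling letter REPLACED by its only use) · ★★★ `partCompat₁₃_of_dvdAt_of_window_of_flowIneq26` (UNDER (2.6) THE COMPATIBLE LEVELS ARE AN INITIAL SEGMENT) · ★★
`partCompat₁₃_iff_dvdAt_of_flowIneq26` · ★★ `not_dvdAt_mono_of_flowIneq26` (the non-fitting = one-block levels are a TOP segment) · ★★ `partCompat₁₃_of_topDvd_of_window_of_flowIneq26` ·
★★ `partCompat₁₃_top_iff_topDvd_of_flowIneq26` · `partCompat₁₃_top_iff_mul_dvd_physicalTorus_of_flowIneq26` · ★ `partCompat₁₃_of_window_of_flowIneq26_of_floor`.  §3 at ANY world `w : WorldP` whose run-`P` couplings are the record's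
(`(w.C P).flow.g = gOfRecord₁₃ θ P`; the CoPH ∕ SepCoPH ∕ SepCoPHV data of record all meet it by their `rfl` faces, e.g. `flow_g_datumOfRecord₁₃CoPH`): ★★★
`partCompat₁₃_of_smallCouplings_of_flowControl_of_topDvd` · ★★ `partCompat₁₃_of_smallCouplings_of_flowControl_of_floor` · ★★★ `partCompat₁₃_top_iff_topDvd_of_smallCouplings_of_flowControl`
· `partCompat₁₃_top_iff_mul_dvd_physicalTorus_of_smallCouplings_of_flowControl`; CoPH-datum instances `…_datumOfRecord₁₃CoPH_…`.  §4 at K1's witness of record θ₁₅ᶜᶜᴹᵂ(j; γ).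

HONEST FRAMING.  Helper lane of K1⁹; count-neutral kernel bookkeeping plus the elementary algebra of (2.6); nothing of [I]∕[III] asserted — (2.6), the window and the top divisibility
enter as HYPOTHESES (the leaves `smallCouplings` ∕ `flowControl` are binders of `Dag.B14_main`, asserted by nobody); NOT a discharge, NOT a refutation.  N11 NOT discharged; K1⁹ NOT
closed, no registered stub of v9 touched; counts unmoved (typed 28∕28 · discharged 5∕27 · A 5∕28).  One finite `𝕋⁴_{L^K}` programme at fixed `ε = L^{−K}`; R4 closes only the
conditional finite-𝕋⁴ rung `BalabanLadder.UV` — NOT ℝ⁴, NOT OS, NOT a mass gap, NOT Clay.  No `sorry`, `axiom`, `def`, `instance`, `notation`.  Sources (SHAPE ∕ bookkeeping only):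
[III] (2.6) p.255, (2.1) p.254, (2.5) p.255, p.257 («the partition … compatible with all other partitions»), Thm 1 p.262; [I] (0.1) p.251, (0.20) p.256, Thm 1 p.259, (0.31) p.259.
-/

noncomputable section

namespace Summit.QuantumFields.YangMills.Theorems.BalabanUVNodesN11RunGuardOfFlowControl

open Literature.MathematicalPhysics.QuantumFieldTheory.Balaban1983to89 T4Continuum Node00 DagBinding
open BalabanUVNodesN11PartCompatOfCouplings (partCompat₁₃_of_log_pow_le log_pow_le_of_dCubeSide_le room_of_dCubeSide_le sitesPerDir_zero_eq)
open BalabanUVNodesN11PartCompatOfTwoSidedRunning (pow_add_ge_add partCompat₁₃_of_upperRunning)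
open BalabanUVNodesN11RunGuardIsTopCube (topDvd_of_partCompat₁₃ dCubeSide_dvd_iff_mul_dvd)

/-! ## §1  The algebra of (2.6): its first half at `n = K` is the upper running w.r.t. the last coupling -/

section Algebra

/-- **★ (2.6) ⇒ THE UPPER RUNNING W.R.T. ANY LATER COUPLING**: `B14.FlowIneq26 g β⁺ β₀ K` (first half at `(i, n)`: `g_n ≤ √(1 + g_n²β⁺(n − i))·g_i`) and `0 < g_k`
(`k ≤ K`) give `1∕g_i² ≤ 1∕g_n² + β⁺·(n − i)` for all `i ≤ n ≤ K` (square, divide by `g_n²g_i²`).  At `n = K` this is the shape p615408 derives from the β-ceiling and p611474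
assumes as (0.31). [cite: Balaban1988Convergent, (2.6) p.255; Balaban1987RG1, (0.31) p.259] -/
theorem inv_sq_le_inv_sq_add_of_flowIneq26 {g : ℕ → ℝ} {β' β₀ : ℝ} {K : ℕ} (h26 : B14.FlowIneq26 g β' β₀ K)
    (hpos : ∀ i, i ≤ K → 0 < g i) {i n : ℕ} (hin : i ≤ n) (hn : n ≤ K) :
    1 / g i ^ 2 ≤ 1 / g n ^ 2 + β' * ((n - i : ℕ) : ℝ) := by
  rcases hin.eq_or_lt with rfl | hlt
  · simp
  have hgi : 0 < g i := hpos i (hin.trans hn)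
  have hgn : 0 < g n := hpos n hn
  have hgi2 : 0 < g i ^ 2 := by positivity
  have hgn2 : 0 < g n ^ 2 := by positivity
  have h1 : g n ≤ Real.sqrt (1 + g n ^ 2 * β' * ((n : ℝ) - i)) * g i := (h26 i n hlt hn).1
  -- `g_n ∕ g_i ≤ √R`, hence `(g_n ∕ g_i)² ≤ R`
  have h2 : g n / g i ≤ Real.sqrt (1 + g n ^ 2 * β' * ((n : ℝ) - i)) := by rwa [div_le_iff₀ hgi]
  have h3 : (g n / g i) ^ 2 ≤ 1 + g n ^ 2 * β' * ((n : ℝ) - i) := (Real.le_sqrt' (by positivity)).1 h2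
  rw [div_pow, div_le_iff₀ hgi2] at h3
  rw [Nat.cast_sub hin]
  calc 1 / g i ^ 2 = g n ^ 2 / (g n ^ 2 * g i ^ 2) := by field_simp
    _ ≤ (1 + g n ^ 2 * β' * ((n : ℝ) - i)) * g i ^ 2 / (g n ^ 2 * g i ^ 2) := by gcongr
    _ = 1 / g n ^ 2 + β' * ((n : ℝ) - i) := by field_simp

/-- **★ (2.6) ⇒ THE UPPER RUNNING W.R.T. THE LAST COUPLING** (`n = K`): `1∕g_i² ≤ 1∕g_K² + β⁺·(K − i)` for every `i ≤ K`.
[cite: Balaban1988Convergent, (2.6) p.255; Balaban1987RG1, (0.31) p.259] -/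
theorem inv_sq_le_inv_sq_top_add_of_flowIneq26 {g : ℕ → ℝ} {β' β₀ : ℝ} {K : ℕ} (h26 : B14.FlowIneq26 g β' β₀ K)
    (hpos : ∀ i, i ≤ K → 0 < g i) {i : ℕ} (hi : i ≤ K) :
    1 / g i ^ 2 ≤ 1 / g K ^ 2 + β' * ((K - i : ℕ) : ℝ) :=
  inv_sq_le_inv_sq_add_of_flowIneq26 h26 hpos hi le_rfl

/-- **(2.6), SECOND HALF, AT `n = K`**: `g_i ≤ (1 + β₀)·g_K` for `i < K` — the couplings below the top are at most `(1+β₀)` times the last one (so a floor on `g_K` is, up to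
`1 + β₀`, a floor on the whole run).  Recorded for consumers; not used below. [cite: Balaban1988Convergent, (2.6) p.255] -/
theorem le_one_add_mul_top_of_flowIneq26 {g : ℕ → ℝ} {β' β₀ : ℝ} {K : ℕ} (h26 : B14.FlowIneq26 g β' β₀ K) {i : ℕ} (hi : i < K) :
    g i ≤ (1 + β₀) * g K :=
  (h26 i K hi le_rfl).2

/-- **THE LOG-LOG STEP**: `0 < g_i`, `0 < g_n ≤ γ`, `1∕g_i² ≤ 1∕g_n² + B·d` with `0 ≤ B`, `B·γ² ≤ 1`, `0 ≤ d` give `log g_i⁻² ≤ log g_n⁻² + d`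
(`log(y + c) ≤ log y + c∕y` and `B·d·g_n² ≤ d`). [cite: Balaban1988Convergent, (2.6) p.255; Balaban1987RG1, (0.31) p.259 (elementary)] -/
theorem log_inv_sq_le_log_inv_sq_add_of_upperRunning {gi gn γ B d : ℝ} (hgi : 0 < gi) (hgn : 0 < gn) (hgnγ : gn ≤ γ)
    (hB0 : 0 ≤ B) (hBγ : B * γ ^ 2 ≤ 1) (hd : 0 ≤ d) (hup : 1 / gi ^ 2 ≤ 1 / gn ^ 2 + B * d) :
    Real.log (gi ^ 2)⁻¹ ≤ Real.log (gn ^ 2)⁻¹ + d := by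
  have hgi2 : 0 < gi ^ 2 := by positivity
  have hgn2 : 0 < gn ^ 2 := by positivity
  have hd0 : (0 : ℝ) ≤ B * d := by positivity
  have h1 : (gi ^ 2)⁻¹ ≤ (gn ^ 2)⁻¹ + B * d := by rw [← one_div, ← one_div]; exact hup
  -- `log(y + c) ≤ log y + c∕y`
  have hlogadd : ∀ {y c : ℝ}, 0 < y → 0 ≤ c → Real.log (y + c) ≤ Real.log y + c / y := by
    intro y c hy hc
    have e : y + c = y * (1 + c / y) := by field_simp
    rw [e, Real.log_mul hy.ne' (by positivity)]
    have := Real.log_le_sub_one_of_pos (show 0 < 1 + c / y by positivity)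
    linarith
  have h2 : Real.log (gi ^ 2)⁻¹ ≤ Real.log (gn ^ 2)⁻¹ + B * d / (gn ^ 2)⁻¹ :=
    (Real.log_le_log (by positivity) h1).trans (hlogadd (by positivity) hd0)
  -- `B·d∕(g_n²)⁻¹ = B·d·g_n² ≤ d`
  have h3 : B * d / (gn ^ 2)⁻¹ ≤ d := by
    rw [div_inv_eq_mul]
    have hg2γ : gn ^ 2 ≤ γ ^ 2 := by gcongr
    calc B * d * gn ^ 2 = (B * gn ^ 2) * d := by ring
      _ ≤ (B * γ ^ 2) * d := by gcongr
      _ ≤ 1 * d := by gcongr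
      _ = d := one_mul _
  linarith

end Algebra

/-! ## §2  Generic θ (`M = L^a`, `r = 1`): window + upper running w.r.t. `g_K` ⇒ the guard collapses to its top level -/

section Record

variable {F : T4Family} {N : ℕ} [NeZero N]

/-- `1 < L` in `ℝ` for the family's `L > 11`. [cite: Balaban1987RG1, (0.1) p.251 (bookkeeping)] -/
private theorem one_lt_L_real (F : T4Family) : (1 : ℝ) < F.L := by
  have := F.hL11
  exact_mod_cast (by omega : 1 < F.L)

/-- **★ THE LEVEL-`n` LOG FLOOR ⇒ THE GUARD UP TO `n`, FROM THE UPPER RUNNING W.R.T. `g_n` ALONE** (generic θ with `θ.τ9.M = F.L^a`, `θ.ν.r = 1`; any `n ≤ K`): if the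
record's run `p` lies in `]0, γ]` up to `K`, `1∕g_i² ≤ 1∕g_n² + B·(n − i)` for `i ≤ n` with `0 ≤ B`, `B·γ² ≤ 1`, there is room `n + a ≤ m + K` and the level-`n` coupling clears
`log g_n⁻² ≤ L^{m+K−n−a}`, then `PartCompat₁₃ θ p n` — every lower level inherits the bound because `log g_i⁻²` grows only log-log below `n` (`≤ log g_n⁻² + (n − i)`) while the room
grows like `L^{n−i}`.  (p623573's argument at a general level, with the β-ceiling letter replaced by its only use, the upper running.)
[cite: Balaban1988Convergent, (2.1) p.254, (2.5) p.255, p.257; Balaban1987RG1, (0.1) p.251, (0.31) p.259] -/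
theorem partCompat₁₃_of_logFloorAt_of_window_of_upperRunningAt (θ : Stage13Params F N) {a : ℕ} (hM : θ.τ9.M = F.L ^ a) (hr : θ.ν.r = 1)
    (p : B12.RunParams) {γ B : ℝ} (hB0 : 0 ≤ B) (hBγ : B * γ ^ 2 ≤ 1)
    (hW : Step.InInterval γ p.K (gOfRecord₁₃ F N θ p)) {n : ℕ} (hnK : n ≤ p.K)
    (hup : ∀ i, i ≤ n → 1 / gOfRecord₁₃ F N θ p i ^ 2 ≤ 1 / gOfRecord₁₃ F N θ p n ^ 2 + B * ((n - i : ℕ) : ℝ))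
    (hroom : n + a ≤ F.m + p.K) (hflr : Real.log (gOfRecord₁₃ F N θ p n ^ 2)⁻¹ ≤ ((F.L ^ (F.m + p.K - n - a) : ℕ) : ℝ)) :
    PartCompat₁₃ F N θ p n := by
  have hL2 : 2 ≤ F.L := by have := F.hL11; omega
  obtain ⟨hgn, hgnγ⟩ := hW n hnK
  refine partCompat₁₃_of_log_pow_le θ hM p n (fun i => F.m + p.K - i - a) (fun i _ hi => by omega) fun i h1 hi => ?_
  rw [hr, pow_one]
  have hstep := log_inv_sq_le_log_inv_sq_add_of_upperRunning (hW i (hi.trans hnK)).1 hgn hgnγ hB0 hBγ (Nat.cast_nonneg (n - i)) (hup i hi)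
  have hexp : F.m + p.K - i - a = (F.m + p.K - n - a) + (n - i) := by omega
  calc Real.log (gOfRecord₁₃ F N θ p i ^ 2)⁻¹
      ≤ ((F.L ^ (F.m + p.K - n - a) : ℕ) : ℝ) + ((n - i : ℕ) : ℝ) := by linarith
    _ ≤ ((F.L ^ (F.m + p.K - n - a) * F.L ^ (n - i) : ℕ) : ℝ) := pow_add_ge_add hL2 _ _
    _ = ((F.L ^ (F.m + p.K - i - a) : ℕ) : ℝ) := by rw [hexp, pow_add]

/-- **★ THE LEVEL-`n` CUBE FITS ⇒ THE GUARD UP TO `n`, FROM THE UPPER RUNNING W.R.T. `g_n` ALONE** (generic θ, `M = L^a`, `r = 1`; any `n ≤ K`): as the previous theorem, the room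
and the log floor at level `n` being READ OFF the divisibility of the torus period by the level-`n` 𝐃-cube (p608879 `room_of_dCubeSide_le`, `log_pow_le_of_dCubeSide_le`).
[cite: Balaban1988Convergent, (2.1) p.254, (2.5) p.255, p.257; Balaban1987RG1, (0.1) p.251, (0.31) p.259] -/
theorem partCompat₁₃_of_dvdAt_of_window_of_upperRunningAt (θ : Stage13Params F N) {a : ℕ} (hM : θ.τ9.M = F.L ^ a) (hr : θ.ν.r = 1)
    (p : B12.RunParams) {γ B : ℝ} (hB0 : 0 ≤ B) (hBγ : B * γ ^ 2 ≤ 1)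
    (hW : Step.InInterval γ p.K (gOfRecord₁₃ F N θ p)) {n : ℕ} (hnK : n ≤ p.K)
    (hup : ∀ i, i ≤ n → 1 / gOfRecord₁₃ F N θ p i ^ 2 ≤ 1 / gOfRecord₁₃ F N θ p n ^ 2 + B * ((n - i : ℕ) : ℝ))
    (hdvd : dCubeSide (F.P p.K).L θ.τ9.M (RkOfRecord (F.P p.K).L θ.ν.r (gOfRecord₁₃ F N θ p n)) n ∣ (F.P p.K).sitesPerDir 0) :
    PartCompat₁₃ F N θ p n := by
  have hL3 : 3 ≤ F.L := by have := F.hL11; omega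
  have hsz : dCubeSide F.L θ.τ9.M (RkOfRecord F.L θ.ν.r (gOfRecord₁₃ F N θ p n)) n ≤ 2 * F.L ^ (F.m + p.K) := by
    have h := Nat.le_of_dvd (Nat.pos_of_ne_zero ((F.P p.K).sitesPerDir_ne_zero 0)) hdvd
    rw [sitesPerDir_zero_eq] at h
    simpa only [T4Family.P_L] using h
  have hflr := log_pow_le_of_dCubeSide_le hL3 hM _ hsz
  rw [hr, pow_one] at hflr
  exact partCompat₁₃_of_logFloorAt_of_window_of_upperRunningAt θ hM hr p hB0 hBγ hW hnK hup (room_of_dCubeSide_le hL3 hM _ hsz) hflr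

/-- **★ THE TOP CUBE FITS ⇒ THE GUARD AT EVERY LEVEL, FROM THE UPPER RUNNING W.R.T. `g_K` ALONE** (`n = K` of the previous theorem; = p623573 `partCompat₁₃_of_topDvd_of_window_of_betaLe`
with its β-ceiling letter replaced by the upper running). [cite: Balaban1988Convergent, (2.1) p.254, (2.5) p.255, p.257; Balaban1987RG1, (0.1) p.251, (0.31) p.259] -/
theorem partCompat₁₃_of_topDvd_of_window_of_upperRunningTop (θ : Stage13Params F N) {a : ℕ} (hM : θ.τ9.M = F.L ^ a) (hr : θ.ν.r = 1)
    (p : B12.RunParams) {γ B : ℝ} (hB0 : 0 ≤ B) (hBγ : B * γ ^ 2 ≤ 1)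
    (hW : Step.InInterval γ p.K (gOfRecord₁₃ F N θ p))
    (hup : ∀ i, i ≤ p.K → 1 / gOfRecord₁₃ F N θ p i ^ 2 ≤ 1 / gOfRecord₁₃ F N θ p p.K ^ 2 + B * ((p.K - i : ℕ) : ℝ))
    (htop : dCubeSide (F.P p.K).L θ.τ9.M (RkOfRecord (F.P p.K).L θ.ν.r (gOfRecord₁₃ F N θ p p.K)) p.K ∣ (F.P p.K).sitesPerDir 0)
    {n : ℕ} (hn : n ≤ p.K) : PartCompat₁₃ F N θ p n :=
  fun j h1 hj => partCompat₁₃_of_dvdAt_of_window_of_upperRunningAt θ hM hr p hB0 hBγ hW le_rfl hup htop j h1 (hj.trans hn)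

/-- **★★★ UNDER (2.6) THE COMPATIBLE LEVELS ARE AN INITIAL SEGMENT: THE LEVEL-`n` CUBE FITS ⇒ COMPATIBLE AT EVERY LEVEL `≤ n`** (generic θ, `M = L^a`, `r = 1`; any `n ≤ K`): a run in
`]0, γ]` satisfying [III] (2.6) `B14.FlowIneq26 (g of record) β⁺ β₀ K` with `0 ≤ β⁺`, `β⁺·γ² ≤ 1`, whose LEVEL-`n` `𝐃_n`-cube divides the torus, is partition-compatible up to `n`.
Contrapositively the levels whose 𝐃-cube does NOT fit (at `M = L^a`: the ONE-BLOCK levels of p618164) are UPWARD CLOSED — a top segment of the run.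
[cite: Balaban1988Convergent, (2.6) p.255, (2.1) p.254, (2.5) p.255, p.257; Balaban1987RG1, (0.1) p.251] -/
theorem partCompat₁₃_of_dvdAt_of_window_of_flowIneq26 (θ : Stage13Params F N) {a : ℕ} (hM : θ.τ9.M = F.L ^ a) (hr : θ.ν.r = 1)
    (p : B12.RunParams) {γ βup β₀ : ℝ} (hβ : 0 ≤ βup) (hβγ : βup * γ ^ 2 ≤ 1)
    (hW : Step.InInterval γ p.K (gOfRecord₁₃ F N θ p))
    (h26 : B14.FlowIneq26 (gOfRecord₁₃ F N θ p) βup β₀ p.K) {n : ℕ} (hnK : n ≤ p.K)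
    (hdvd : dCubeSide (F.P p.K).L θ.τ9.M (RkOfRecord (F.P p.K).L θ.ν.r (gOfRecord₁₃ F N θ p n)) n ∣ (F.P p.K).sitesPerDir 0) :
    PartCompat₁₃ F N θ p n :=
  partCompat₁₃_of_dvdAt_of_window_of_upperRunningAt θ hM hr p hβ hβγ hW hnK
    (fun _ hi => inv_sq_le_inv_sq_add_of_flowIneq26 h26 (fun k hk => (hW k hk).1) hi hnK) hdvd

/-- **★★ UNDER (2.6): `PartCompat₁₃ θ p n ⟺` THE LEVEL-`n` CUBE FITS** (`1 ≤ n ≤ K`) — the `n`-level guard is its last clause. [cite: Balaban1988Convergent, (2.6) p.255, p.257] -/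
theorem partCompat₁₃_iff_dvdAt_of_flowIneq26 (θ : Stage13Params F N) {a : ℕ} (hM : θ.τ9.M = F.L ^ a) (hr : θ.ν.r = 1)
    (p : B12.RunParams) {γ βup β₀ : ℝ} (hβ : 0 ≤ βup) (hβγ : βup * γ ^ 2 ≤ 1)
    (hW : Step.InInterval γ p.K (gOfRecord₁₃ F N θ p))
    (h26 : B14.FlowIneq26 (gOfRecord₁₃ F N θ p) βup β₀ p.K) {n : ℕ} (h1 : 1 ≤ n) (hnK : n ≤ p.K) :
    PartCompat₁₃ F N θ p n ↔
      dCubeSide (F.P p.K).L θ.τ9.M (RkOfRecord (F.P p.K).L θ.ν.r (gOfRecord₁₃ F N θ p n)) n ∣ (F.P p.K).sitesPerDir 0 :=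
  ⟨fun h => h n h1 le_rfl, fun h => partCompat₁₃_of_dvdAt_of_window_of_flowIneq26 θ hM hr p hβ hβγ hW h26 hnK h⟩

/-- **★★ UNDER (2.6) THE NON-FITTING LEVELS ARE A TOP SEGMENT**: if the level-`i` 𝐃-cube does not divide the torus period, then neither does the level-`n` cube for any `n` with
`i ≤ n ≤ K` (`1 ≤ i`).  At `M = L^a` these are p618164's ONE-BLOCK levels — so along a run satisfying (2.6) print's compatible partitions hold up to a level `n₀` and every 𝐃-partition
above `n₀` is the whole torus. [cite: Balaban1988Convergent, (2.6) p.255, (2.1) p.254, p.257; Balaban1987RG1, (0.1) p.251] -/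
theorem not_dvdAt_mono_of_flowIneq26 (θ : Stage13Params F N) {a : ℕ} (hM : θ.τ9.M = F.L ^ a) (hr : θ.ν.r = 1)
    (p : B12.RunParams) {γ βup β₀ : ℝ} (hβ : 0 ≤ βup) (hβγ : βup * γ ^ 2 ≤ 1)
    (hW : Step.InInterval γ p.K (gOfRecord₁₃ F N θ p))
    (h26 : B14.FlowIneq26 (gOfRecord₁₃ F N θ p) βup β₀ p.K) {i n : ℕ} (h1 : 1 ≤ i) (hin : i ≤ n) (hnK : n ≤ p.K)
    (hi : ¬ dCubeSide (F.P p.K).L θ.τ9.M (RkOfRecord (F.P p.K).L θ.ν.r (gOfRecord₁₃ F N θ p i)) i ∣ (F.P p.K).sitesPerDir 0) :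
    ¬ dCubeSide (F.P p.K).L θ.τ9.M (RkOfRecord (F.P p.K).L θ.ν.r (gOfRecord₁₃ F N θ p n)) n ∣ (F.P p.K).sitesPerDir 0 :=
  fun hn => hi (partCompat₁₃_of_dvdAt_of_window_of_flowIneq26 θ hM hr p hβ hβγ hW h26 hnK hn i h1 hin)

/-- **★★ THE RUN GUARD FROM THE WINDOW AND (2.6): THE TOP CUBE FITS ⇒ COMPATIBLE AT EVERY LEVEL** (generic θ, `M = L^a`, `r = 1`): a run in `]0, γ]` up to `K` satisfying [III] (2.6)
`B14.FlowIneq26 (g of record) β⁺ β₀ K` with `0 ≤ β⁺`, `β⁺·γ² ≤ 1`, whose TOP `𝐃_K`-cube divides the torus, is partition-compatible up to every `n ≤ K`.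
[cite: Balaban1988Convergent, (2.6) p.255, (2.1) p.254, (2.5) p.255, p.257; Balaban1987RG1, (0.1) p.251] -/
theorem partCompat₁₃_of_topDvd_of_window_of_flowIneq26 (θ : Stage13Params F N) {a : ℕ} (hM : θ.τ9.M = F.L ^ a) (hr : θ.ν.r = 1)
    (p : B12.RunParams) {γ βup β₀ : ℝ} (hβ : 0 ≤ βup) (hβγ : βup * γ ^ 2 ≤ 1)
    (hW : Step.InInterval γ p.K (gOfRecord₁₃ F N θ p))
    (h26 : B14.FlowIneq26 (gOfRecord₁₃ F N θ p) βup β₀ p.K)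
    (htop : dCubeSide (F.P p.K).L θ.τ9.M (RkOfRecord (F.P p.K).L θ.ν.r (gOfRecord₁₃ F N θ p p.K)) p.K ∣ (F.P p.K).sitesPerDir 0)
    {n : ℕ} (hn : n ≤ p.K) : PartCompat₁₃ F N θ p n :=
  partCompat₁₃_of_topDvd_of_window_of_upperRunningTop θ hM hr p hβ hβγ hW
    (fun _ hi => inv_sq_le_inv_sq_top_add_of_flowIneq26 h26 (fun k hk => (hW k hk).1) hi) htop hn

/-- **★★ UNDER (2.6) THE GUARD AT FULL LENGTH IS «THE TOP CUBE FITS»** (generic θ, `M = L^a`, `r = 1`, `K ≥ 1`, window with `β⁺γ² ≤ 1`):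
`PartCompat₁₃ θ p K ⟺ L^K·M·R_K(g_K) ∣ 2L^{m+K}` — print's p. 257 standing assumption AT THE TOP SCALE and nothing about the lower levels.
[cite: Balaban1988Convergent, (2.6) p.255, p.257; Balaban1987RG1, (0.1) p.251] -/
theorem partCompat₁₃_top_iff_topDvd_of_flowIneq26 (θ : Stage13Params F N) {a : ℕ} (hM : θ.τ9.M = F.L ^ a) (hr : θ.ν.r = 1)
    (p : B12.RunParams) (hK : 1 ≤ p.K) {γ βup β₀ : ℝ} (hβ : 0 ≤ βup) (hβγ : βup * γ ^ 2 ≤ 1)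
    (hW : Step.InInterval γ p.K (gOfRecord₁₃ F N θ p))
    (h26 : B14.FlowIneq26 (gOfRecord₁₃ F N θ p) βup β₀ p.K) :
    PartCompat₁₃ F N θ p p.K ↔
      dCubeSide (F.P p.K).L θ.τ9.M (RkOfRecord (F.P p.K).L θ.ν.r (gOfRecord₁₃ F N θ p p.K)) p.K ∣ (F.P p.K).sitesPerDir 0 :=
  ⟨topDvd_of_partCompat₁₃ θ p hK, fun h => partCompat₁₃_of_topDvd_of_window_of_flowIneq26 θ hM hr p hβ hβγ hW h26 h le_rfl⟩

/-- **… EQUIVALENTLY `M·R_K(g_K) ∣ 2·L^m`** — the physical torus of side `2L^m` contains one top-scale 𝐃-cube. [cite: Balaban1988Convergent, (2.6) p.255, (2.1) p.254, p.257; Balaban1987RG1, (0.1) p.251] -/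
theorem partCompat₁₃_top_iff_mul_dvd_physicalTorus_of_flowIneq26 (θ : Stage13Params F N) {a : ℕ} (hM : θ.τ9.M = F.L ^ a) (hr : θ.ν.r = 1)
    (p : B12.RunParams) (hK : 1 ≤ p.K) {γ βup β₀ : ℝ} (hβ : 0 ≤ βup) (hβγ : βup * γ ^ 2 ≤ 1)
    (hW : Step.InInterval γ p.K (gOfRecord₁₃ F N θ p))
    (h26 : B14.FlowIneq26 (gOfRecord₁₃ F N θ p) βup β₀ p.K) :
    PartCompat₁₃ F N θ p p.K ↔ θ.τ9.M * RkOfRecord F.L θ.ν.r (gOfRecord₁₃ F N θ p p.K) ∣ 2 * F.L ^ F.m := by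
  rw [partCompat₁₃_top_iff_topDvd_of_flowIneq26 θ hM hr p hK hβ hβγ hW h26, sitesPerDir_zero_eq]
  simp only [T4Family.P_L]
  exact dCubeSide_dvd_iff_mul_dvd (by have := F.hL11; omega)

/-- **★ THE FLOOR FORM**: window + (2.6) (`0 ≤ β⁺`) + room `a ≤ m` + the floor `log(1∕g_K² + β⁺) ≤ L^{m−a}` on the LAST coupling ⇒ `PartCompat₁₃ θ p n`, `n ≤ K`
(p611474 `partCompat₁₃_of_upperRunning` with `g := g_K`, `β′ := β⁺∕log L`; no `β⁺γ² ≤ 1` needed here). [cite: Balaban1988Convergent, (2.6) p.255, (2.1) p.254, (2.5) p.255, p.257; Balaban1987RG1, (0.1) p.251, (0.31) p.259] -/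
theorem partCompat₁₃_of_window_of_flowIneq26_of_floor (θ : Stage13Params F N) {a : ℕ} (hM : θ.τ9.M = F.L ^ a) (hr : θ.ν.r = 1)
    (p : B12.RunParams) (ha : a ≤ F.m) {γ βup β₀ : ℝ} (hβ : 0 ≤ βup)
    (hW : Step.InInterval γ p.K (gOfRecord₁₃ F N θ p))
    (h26 : B14.FlowIneq26 (gOfRecord₁₃ F N θ p) βup β₀ p.K)
    (hfloor : Real.log (1 / gOfRecord₁₃ F N θ p p.K ^ 2 + βup) ≤ ((F.L ^ (F.m - a) : ℕ) : ℝ))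
    {n : ℕ} (hn : n ≤ p.K) : PartCompat₁₃ F N θ p n := by
  have hlogL : 0 < Real.log F.L := Real.log_pos (one_lt_L_real F)
  have hgK : 0 < gOfRecord₁₃ F N θ p p.K := (hW p.K le_rfl).1
  refine partCompat₁₃_of_upperRunning θ hM hr p ha (g := gOfRecord₁₃ F N θ p p.K) (β' := βup / Real.log F.L) hgK
    (div_nonneg hβ hlogL.le) (fun i hi => ⟨(hW i hi).1, ?_⟩) ?_ hn
  · have h := inv_sq_le_inv_sq_top_add_of_flowIneq26 h26 (fun k hk => (hW k hk).1) hi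
    have heq : βup / Real.log F.L * ((p.K - i : ℕ) : ℝ) * Real.log F.L = βup * ((p.K - i : ℕ) : ℝ) := by
      field_simp
    rw [heq]
    exact h
  · have heq : βup / Real.log F.L * Real.log F.L = βup := by field_simp
    rw [heq]
    exact hfloor

end Record

/-! ## §3  At a world whose run couplings are the record's: the guard from the node's OWN leaves `smallCouplings` + `flowControl` -/

section World

variable {F : T4Family} {N : ℕ} [NeZero N]

/-- **★★★ THE RUN GUARD FROM N11's OWN ANTECEDENTS — TOP-CUBE FORM**: at `θ.τ9.M = F.L^a`, `θ.ν.r = 1`, a world `w` whose run-`P` couplings are the record's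
(`(w.C P).flow.g = gOfRecord₁₃ θ P`), with `0 ≤ w.βup`, `w.βup·w.γ² ≤ 1`: the leaves `(leavesP w P).smallCouplings` (the window `]0, w.γ]`) and `(leavesP w P).flowControl`
([III] (2.6) with `β′ = w.βup`) — BOTH antecedents of `Dag.B14_main (leavesP w P)` — and the TOP divisibility give `PartCompat₁₃ θ P n` for every `n ≤ K`.
[cite: Balaban1988Convergent, (2.6) p.255, p.257, Thm 1 p.262; Balaban1987RG1, Thm 1 p.259 (the window), (0.1) p.251] -/
theorem partCompat₁₃_of_smallCouplings_of_flowControl_of_topDvd (θ : Stage13Params F N) {a : ℕ} (hM : θ.τ9.M = F.L ^ a) (hr : θ.ν.r = 1)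
    (w : WorldP) (hβ : 0 ≤ w.βup) (hβγ : w.βup * w.γ ^ 2 ≤ 1) (P : B12.RunParams) (hg : (w.C P).flow.g = gOfRecord₁₃ F N θ P)
    (hsc : (leavesP w P).smallCouplings) (hfc : (leavesP w P).flowControl)
    (htop : dCubeSide (F.P P.K).L θ.τ9.M (RkOfRecord (F.P P.K).L θ.ν.r (gOfRecord₁₃ F N θ P P.K)) P.K ∣ (F.P P.K).sitesPerDir 0)
    {n : ℕ} (hn : n ≤ P.K) : PartCompat₁₃ F N θ P n := by
  have hW : Step.InInterval w.γ P.K (gOfRecord₁₃ F N θ P) := by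
    have h : Step.InInterval w.γ P.K (w.C P).flow.g := (Step.inInterval_iff _ _ _).1 hsc
    rwa [hg] at h
  have h26 : B14.FlowIneq26 (gOfRecord₁₃ F N θ P) w.βup w.β₀ P.K := by
    have h : B14.FlowIneq26 (w.C P).flow.g w.βup w.β₀ P.K := hfc
    rwa [hg] at h
  exact partCompat₁₃_of_topDvd_of_window_of_flowIneq26 θ hM hr P hβ hβγ hW h26 htop hn

/-- **★★ THE RUN GUARD FROM N11's OWN ANTECEDENTS — FLOOR FORM** (`a ≤ m`, `0 ≤ w.βup`; no `βup·γ² ≤ 1`): `smallCouplings` + `flowControl` + `log(1∕g_K² + w.βup) ≤ L^{m−a}` ⇒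
`PartCompat₁₃ θ P n`, `n ≤ K`. [cite: Balaban1988Convergent, (2.6) p.255, p.257; Balaban1987RG1, Thm 1 p.259, (0.31) p.259] -/
theorem partCompat₁₃_of_smallCouplings_of_flowControl_of_floor (θ : Stage13Params F N) {a : ℕ} (hM : θ.τ9.M = F.L ^ a) (hr : θ.ν.r = 1) (ha : a ≤ F.m)
    (w : WorldP) (hβ : 0 ≤ w.βup) (P : B12.RunParams) (hg : (w.C P).flow.g = gOfRecord₁₃ F N θ P)
    (hsc : (leavesP w P).smallCouplings) (hfc : (leavesP w P).flowControl)
    (hfloor : Real.log (1 / gOfRecord₁₃ F N θ P P.K ^ 2 + w.βup) ≤ ((F.L ^ (F.m - a) : ℕ) : ℝ))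
    {n : ℕ} (hn : n ≤ P.K) : PartCompat₁₃ F N θ P n := by
  have hW : Step.InInterval w.γ P.K (gOfRecord₁₃ F N θ P) := by
    have h : Step.InInterval w.γ P.K (w.C P).flow.g := (Step.inInterval_iff _ _ _).1 hsc
    rwa [hg] at h
  have h26 : B14.FlowIneq26 (gOfRecord₁₃ F N θ P) w.βup w.β₀ P.K := by
    have h : B14.FlowIneq26 (w.C P).flow.g w.βup w.β₀ P.K := hfc
    rwa [hg] at h
  exact partCompat₁₃_of_window_of_flowIneq26_of_floor θ hM hr P ha hβ hW h26 hfloor hn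

/-- **★★★ INSIDE N11's NODE THE GUARD AT FULL LENGTH IS «THE TOP CUBE FITS»** (`K ≥ 1`): given the node's antecedents `smallCouplings` and `flowControl` at a world whose run couplings are
the record's (`0 ≤ w.βup`, `w.βup·w.γ² ≤ 1`), `PartCompat₁₃ θ P K ⟺ L^K·M·R_K(g_K) ∣ 2L^{m+K}`. [cite: Balaban1988Convergent, (2.6) p.255, p.257, Thm 1 p.262; Balaban1987RG1, (0.1) p.251] -/
theorem partCompat₁₃_top_iff_topDvd_of_smallCouplings_of_flowControl (θ : Stage13Params F N) {a : ℕ} (hM : θ.τ9.M = F.L ^ a) (hr : θ.ν.r = 1)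
    (w : WorldP) (hβ : 0 ≤ w.βup) (hβγ : w.βup * w.γ ^ 2 ≤ 1) (P : B12.RunParams) (hK : 1 ≤ P.K) (hg : (w.C P).flow.g = gOfRecord₁₃ F N θ P)
    (hsc : (leavesP w P).smallCouplings) (hfc : (leavesP w P).flowControl) :
    PartCompat₁₃ F N θ P P.K ↔
      dCubeSide (F.P P.K).L θ.τ9.M (RkOfRecord (F.P P.K).L θ.ν.r (gOfRecord₁₃ F N θ P P.K)) P.K ∣ (F.P P.K).sitesPerDir 0 :=
  ⟨topDvd_of_partCompat₁₃ θ P hK,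
    fun h => partCompat₁₃_of_smallCouplings_of_flowControl_of_topDvd θ hM hr w hβ hβγ P hg hsc hfc h le_rfl⟩

/-- **… EQUIVALENTLY `M·R_K(g_K) ∣ 2·L^m`** inside the node. [cite: Balaban1988Convergent, (2.6) p.255, (2.1) p.254, p.257; Balaban1987RG1, (0.1) p.251] -/
theorem partCompat₁₃_top_iff_mul_dvd_physicalTorus_of_smallCouplings_of_flowControl (θ : Stage13Params F N) {a : ℕ} (hM : θ.τ9.M = F.L ^ a) (hr : θ.ν.r = 1)
    (w : WorldP) (hβ : 0 ≤ w.βup) (hβγ : w.βup * w.γ ^ 2 ≤ 1) (P : B12.RunParams) (hK : 1 ≤ P.K) (hg : (w.C P).flow.g = gOfRecord₁₃ F N θ P)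
    (hsc : (leavesP w P).smallCouplings) (hfc : (leavesP w P).flowControl) :
    PartCompat₁₃ F N θ P P.K ↔ θ.τ9.M * RkOfRecord F.L θ.ν.r (gOfRecord₁₃ F N θ P P.K) ∣ 2 * F.L ^ F.m := by
  rw [partCompat₁₃_top_iff_topDvd_of_smallCouplings_of_flowControl θ hM hr w hβ hβγ P hK hg hsc hfc, sitesPerDir_zero_eq]
  simp only [T4Family.P_L]
  exact dCubeSide_dvd_iff_mul_dvd (by have := F.hL11; omega)

/-- **AT A WORLD BOUND TO THE CoPH DATUM OF `θ`** (`w.C = (datumOfRecord₁₃CoPH θ h).C`, the binder of the K1-class record worlds; the coupling face is `rfl`): the node's antecedents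
`smallCouplings` + `flowControl`, `0 ≤ w.βup`, `w.βup·w.γ² ≤ 1` and the top divisibility give `PartCompat₁₃ θ P n`, `n ≤ K`. [cite: Balaban1988Convergent, (2.6) p.255, p.257, Thm 1 p.262] -/
theorem partCompat₁₃_datumOfRecord₁₃CoPH_of_smallCouplings_of_flowControl_of_topDvd {θ : Stage13HParams F N} (h : θ.Provisos₁₃CoPH F N)
    {a : ℕ} (hM : θ.τ9.M = F.L ^ a) (hr : θ.ν.r = 1)
    (w : WorldP) (hC : w.C = (datumOfRecord₁₃CoPH F N θ h).C) (hβ : 0 ≤ w.βup) (hβγ : w.βup * w.γ ^ 2 ≤ 1) (P : B12.RunParams)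
    (hsc : (leavesP w P).smallCouplings) (hfc : (leavesP w P).flowControl)
    (htop : dCubeSide (F.P P.K).L θ.τ9.M (RkOfRecord (F.P P.K).L θ.ν.r (gOfRecord₁₃ F N θ.toStage13Params P P.K)) P.K ∣ (F.P P.K).sitesPerDir 0)
    {n : ℕ} (hn : n ≤ P.K) : PartCompat₁₃ F N θ.toStage13Params P n :=
  partCompat₁₃_of_smallCouplings_of_flowControl_of_topDvd θ.toStage13Params hM hr w hβ hβγ P (by rw [hC]; rfl) hsc hfc htop hn

/-- **AT A WORLD BOUND TO THE CoPH DATUM — FLOOR FORM** (`a ≤ m`, `0 ≤ w.βup`). [cite: Balaban1988Convergent, (2.6) p.255, p.257, Thm 1 p.262; Balaban1987RG1, (0.31) p.259] -/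
theorem partCompat₁₃_datumOfRecord₁₃CoPH_of_smallCouplings_of_flowControl_of_floor {θ : Stage13HParams F N} (h : θ.Provisos₁₃CoPH F N)
    {a : ℕ} (hM : θ.τ9.M = F.L ^ a) (hr : θ.ν.r = 1) (ha : a ≤ F.m)
    (w : WorldP) (hC : w.C = (datumOfRecord₁₃CoPH F N θ h).C) (hβ : 0 ≤ w.βup) (P : B12.RunParams)
    (hsc : (leavesP w P).smallCouplings) (hfc : (leavesP w P).flowControl)
    (hfloor : Real.log (1 / gOfRecord₁₃ F N θ.toStage13Params P P.K ^ 2 + w.βup) ≤ ((F.L ^ (F.m - a) : ℕ) : ℝ))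
    {n : ℕ} (hn : n ≤ P.K) : PartCompat₁₃ F N θ.toStage13Params P n :=
  partCompat₁₃_of_smallCouplings_of_flowControl_of_floor θ.toStage13Params hM hr ha w hβ P (by rw [hC]; rfl) hsc hfc hfloor hn

end World

/-! ## §4  At K1's witness of record `θ₁₅ᶜᶜᴹᵂ(j; γ)` (`M = L^j`, `r = 1`) -/

section Witness

variable (F : T4Family) (N : ℕ) [NeZero N] (j : ℕ) (γ ε₀ ε₂₉ B₃ B₃' a₀ a₁ : ℝ)

/-- **★ AT θ₁₅ᶜᶜᴹᵂ(j; γ): ON A WINDOWED RUN SATISFYING (2.6) (`β⁺·γ′² ≤ 1`), `PartCompat₁₃` AT FULL LENGTH ⟺ `L^j·R_K(g_K) ∣ 2L^m`.**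
[cite: Balaban1988Convergent, (2.6) p.255, (2.1) p.254, p.257; Balaban1987RG1, (0.1) p.251; Balaban1989LargeFieldI, (2.1) p.182] -/
theorem partCompat₁₃_theta13OfThm1CCMW_top_iff_mul_dvd_of_flowIneq26 (p : B12.RunParams) (hK : 1 ≤ p.K) {γ' βup β₀ : ℝ} (hβ : 0 ≤ βup) (hβγ : βup * γ' ^ 2 ≤ 1)
    (hW : Step.InInterval γ' p.K (gOfRecord₁₃ F N (theta13OfThm1CCMW F N j γ ε₀ ε₂₉ B₃ B₃' a₀ a₁) p))
    (h26 : B14.FlowIneq26 (gOfRecord₁₃ F N (theta13OfThm1CCMW F N j γ ε₀ ε₂₉ B₃ B₃' a₀ a₁) p) βup β₀ p.K) :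
    PartCompat₁₃ F N (theta13OfThm1CCMW F N j γ ε₀ ε₂₉ B₃ B₃' a₀ a₁) p p.K ↔
      F.L ^ j * RkOfRecord F.L 1 (gOfRecord₁₃ F N (theta13OfThm1CCMW F N j γ ε₀ ε₂₉ B₃ B₃' a₀ a₁) p p.K) ∣ 2 * F.L ^ F.m := by
  have h := partCompat₁₃_top_iff_mul_dvd_physicalTorus_of_flowIneq26 (theta13OfThm1CCMW F N j γ ε₀ ε₂₉ B₃ B₃' a₀ a₁)
    (theta13OfThm1CCMW_τ9_M F N j γ ε₀ ε₂₉ B₃ B₃' a₀ a₁) (theta13OfThm1CCMW_r F N j γ ε₀ ε₂₉ B₃ B₃' a₀ a₁) p hK hβ hβγ hW h26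
  rw [theta13OfThm1CCMW_τ9_M, theta13OfThm1CCMW_r] at h
  exact h

end Witness

end Summit.QuantumFields.YangMills.Theorems.BalabanUVNodesN11RunGuardOfFlowControl

end
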